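import Summits.ABC.IUTFork.Joshi.HodgeTheatersJoshi
import HarnessLib

/-!
# Non-vacuity witnesses for the §10.11 interface structures of `Joshi/HodgeTheatersJoshi.lean`
# (ATS III, arXiv 2401.13508v4 — `ArithmeticoidAbsDatum`, `HodgeTheaterDatum`, `HodgeTheater`, and the claim-Props
# `HodgeTheatersIsomorphic`, `ArithFrobenioidsOfModuli` shown SATISFIABLE)

Proof-only companion (abc-iut cell, branch E, seat abc-iut-E-t32, slot T-34b; E-plan-2 RULING 08:35Z (4): «authors first for NV witnesses
of their own interface structures»; rung LADDER-ABC:A2.E). TAKES NO SIDE on [IUTchIII] Cor. 3.12 or on any author; typed ≠ proved.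
PURPOSE: every `structure` the typing file introduces is INHABITED (so no statement over them quantifies over an empty type), and the two
claim-`Prop`s of §10.11 are SATISFIABLE (they hold in a toy datum), hence not contradictory as typed. The residue-field values are HONEST
(`ℚ ↪ ℚ_2` with `|−|_2`, through seat E-t32's `Frob.normAbs`); the places / points / holomorphoids / tempered-Frobenioid data are labelled TOY
(one place, one point, one holomorphoid, trivial local data) — NOT a model of Joshi's curves, `𝒴_L`, or Hodge theaters. With one holomorphoid the
toy says nothing about whether DISTINCT holomorphoids give isomorphic theaters (Thm. 10.11.5.1's content); for the global constituent under
placewise equivalent values see `Joshi/HodgeTheatersJoshiGlobalIso.lean`. [claim: Joshi2024ATS3, status: disputed]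
-/

noncomputable section

namespace Summit.ABC.IUTFork.Joshi.ATS3

/-! ## 1. `ArithmeticoidAbsDatum` — inhabited by the honest values `ℚ ↪ (ℚ_2, |−|_2)` at a single place -/

/-- One place, one point over it, residue field `ℚ_2` with `|−|_2`, and `ℚ ↪ ℚ_2`: an (honest, one-place) inhabitant of
`ArithmeticoidAbsDatum ℚ`. [folklore] -/
def witnessAbsDatum : ArithmeticoidAbsDatum ℚ Unit (fun _ => Unit) (fun _ _ => ℚ_[2]) where
  abs _ _ := Frob.normAbs ℚ_[2]
  emb _ _ := Rat.castHom ℚ_[2]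

/-- `ArithmeticoidAbsDatum` is inhabited. [folklore] -/
theorem nonempty_arithmeticoidAbsDatum : Nonempty (ArithmeticoidAbsDatum ℚ Unit (fun _ => Unit) (fun _ _ => ℚ_[2])) :=
  ⟨witnessAbsDatum⟩

/-- The constructed `Frob(arith(ℚ)_y)` of the witness reads `|x|_2` on `x ∈ ℚ^*` (sanity check of `val_frobArith_div`). [folklore] -/
theorem witness_frobArith_div (x : ℚˣ) (v : Unit) :
    (((witnessAbsDatum.frobArith (fun _ => ())).div x v : ℝˣ) : ℝ) = ‖((x : ℚ) : ℚ_[2])‖ := rfl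

/-! ## 2. A TOY descent datum and Hodge-theater datum — `HodgeTheaterDatum`, `HodgeTheater` inhabited -/

/-- TOY descent datum (seat E-t10's `ModuliDescentDatum`): one valuation upstairs and downstairs, one point each, identity projection.
NOT a model of §3.1/§3.3. [folklore] -/
def toyDescent : ModuliDescentDatum where
  VL' := Unit
  Vmod := Unit
  LiesOver _ _ := True
  sel := id
  sel_liesOver _ := trivial
  sel_injective := Function.injective_id
  Y _ := Unit
  Ymod _ := Unit
  proj _ _ _ y := y

/-- TOY Hodge-theater datum over `toyDescent`: one holomorphoid, trivial local tempered-Frobenioid data (`FT = PUnit`, all local «isomorphisms»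
exist), and the GLOBAL Frobenioids given HONESTLY by the value construction of §2 of the typing file on `witnessAbsDatum` (perfection /
realification of `Frob(L_mod)` set to the same constructions — TOY identification). [folklore] -/
def toyHodgeTheaterDatum : HodgeTheaterDatum toyDescent PUnit.{2} where
  Hol := Unit
  pt _ _ := ()
  ATS _ := Unit
  localOf _ _ := ()
  arithOfPoint _ _ := ()
  frobTempAt _ _ := PUnit.unit
  IsoFT _ _ := Unit
  frobArith y := witnessAbsDatum.frobArith y
  frobArithR y := witnessAbsDatum.frobArithR y
  frobModPf := witnessAbsDatum.frobArith fun _ => ()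
  frobModR := witnessAbsDatum.frobArithR fun _ => ()

/-- `HodgeTheaterDatum` is inhabited. [folklore] -/
theorem nonempty_hodgeTheaterDatum : Nonempty (HodgeTheaterDatum toyDescent PUnit.{2}) := ⟨toyHodgeTheaterDatum⟩

/-- `HodgeTheater` is inhabited (the theater (10.11.4.1) of the toy holomorphoid). [folklore] -/
theorem nonempty_hodgeTheater : Nonempty toyHodgeTheaterDatum.HodgeTheater := ⟨toyHodgeTheaterDatum.hodgeTheaterOf ()⟩

/-! ## 3. The claim-Props of §10.11 are satisfiable -/

/-- In the toy datum Thm. 10.11.5.1's `HodgeTheatersIsomorphic` HOLDS (one holomorphoid; identity isomorphisms) — so the claim-Prop is a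
genuine, satisfiable condition as typed. Says nothing about Joshi's claim for DISTINCT holomorphoids. [folklore] -/
theorem toy_hodgeTheatersIsomorphic : toyHodgeTheaterDatum.HodgeTheatersIsomorphic := fun h₁ h₂ => by
  cases h₁; cases h₂
  exact ⟨⟨fun _ => (), ElementaryFrobenioid.Iso.refl _⟩⟩

/-- In the toy datum Thm. 10.11.3.1 (3)'s `ArithFrobenioidsOfModuli` HOLDS (TOY identification of `Frob(L_mod)^pf`, `Frob(L_mod)^ℝ` with the
value constructions; identity isomorphisms) — satisfiable as typed. [folklore] -/
theorem toy_arithFrobenioidsOfModuli : toyHodgeTheaterDatum.ArithFrobenioidsOfModuli := fun y => by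
  obtain rfl : y = fun _ => () := funext fun _ => rfl
  exact ⟨ElementaryFrobenioid.IsIso.refl _, ElementaryFrobenioid.IsIso.refl _⟩

end Summit.ABC.IUTFork.Joshi.ATS3

end
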